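import Summits.BirchSwinnertonDyer.Rank1Residual.GaloisImage.TameThreeTorsionValuationCaseA
import Summits.BirchSwinnertonDyer.Rank1Residual.GaloisImage.TameNineTorsionValuation
import Literature.NumberTheory.EllipticCurves.PointDivisibilityProofs
import Literature.NumberTheory.EllipticCurves.TorsionCardinality
import Mathlib.FieldTheory.IsAlgClosed.Basic
import HarnessLib

/-!
# Torsion witnesses on a Kodaira-`III`-shaped integral model at `3`: a point of order `9` whose
# abscissa has valuation `13/27` (CASE A), resp. points of order `3` and `9` with abscissae of
# valuation `1/4` and `17/36` (CASE B) (cell `b2b-bsdres`, team n1011, seat p14 gen 2, OWNERS row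
# T-b9 'tame tower at 3', step S6 — the inputs of the inertia criterion)

HONEST FRAMING (cell `b2b-bsdres`, run/shared/lean/b2b/bsd-rank1-residual/, verbatim in every
file): the goal of the cell is to DELETE the COMBINATION-SHAPED residual classes of the
Birch–Swinnerton-Dyer formula for ALL analytic-rank `≤ 1` elliptic curves over `ℚ` — "full BSD
formula for every rank `≤ 1` curve in class `C`" assembled STRICTLY from published theorems — so
that the rank-`≤ 1` remainder becomes exactly the CONSTRUCTION-SHAPED classes, which are TYPED
(missing-input `Prop`s), NOT attempted. This is not "finishing BSD". Team n1011 (N10 / N11, the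
additive block X4 ∧ `p = 3`): research route on the CONSTRUCTION-SHAPED class X4; no claim beyond the
stated classes; nothing is booked. Theorems only (no definition, no named fact).

## What this file proves

For an integral Weierstrass equation `V` which is `III`-shaped at `3` (`3 ∣ b₂`, `3 ∥ b₄`, `9 ∣ b₆`)
and elliptic over `ℚ`, on the geometric points of `V_ℚ = V.map (ℤ → ℚ)`:

* `exists_nineTorsion_valuation_pow_27_eq` — CASE A (`3 ∥ b₂`): there is a point `Q` with `9Q = O`,
  `Q = (x, y)`, `x ≠ 0` and **`v(x)²⁷ = v(3)¹³`** (a point of order `9` above the `3`-torsion point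
  whose abscissa has `v(ξ)³ = v(3)`; steps S1 + S2);
* `exists_threeTorsion_valuation_pow_4_eq` — CASE B (`9 ∣ b₂`): a point `P` with `3P = O`,
  `P = (ξ, η)`, `ξ ≠ 0`, **`v(ξ)⁴ = v(3)`**;
* `exists_nineTorsion_valuation_pow_36_eq` — CASE B: a point `Q` with `9Q = O`, `Q = (x, y)`,
  `x ≠ 0`, **`v(x)³⁶ = v(3)¹⁷`**.

These are exactly the hypotheses of the inertia criterion of n1011-p02's
`GaloisImage/ThreeAdicTowerInertiaCriterion.lean` (`…_of_valuation_X_pow_eq`, `27 ∣ d`; and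
`…_of_not_three_dvd`, `9 ∣ d`, with `4 ∣ #ρ̄₃(I)` from the CASE-B `3`-torsion witness).  Inputs:
divisibility of `E(ℚ̄)` (`zsmul_geomPoints_surjective_holds`), `x(3Q)·ψ₃(x(Q))² = Φ₃(x(Q))`
(`mul_eval_ΨSq_of_zsmul_eq`), `[3]P = O ↔ ψ₃(x(P)) = 0` (`zsmul_some_eq_zero_iff_eval_ΨSq`).
Step S6 inputs only; the tower theorem itself is assembled once the criterion file lands.
-/

noncomputable section

open scoped Classical

open Polynomial WeierstrassCurve

namespace Summit.BirchSwinnertonDyer.Rank1Residual.GaloisImage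

open Literature.NumberTheory.EllipticCurves

variable (V : WeierstrassCurve ℤ)

/-- The curve underlying `geomPoints (V_ℚ)` is `V` read in `ℚ̄`. [folklore] -/
theorem baseChange_map_intCast_eq :
    @WeierstrassCurve.baseChange ℚ _ (V.map (Int.castRingHom ℚ)) (AlgebraicClosure ℚ) _
        (@AlgebraicClosure.instAlgebra ℚ _ ℚ _ _) =
      V.map (Int.castRingHom (AlgebraicClosure ℚ)) := by
  rw [baseChange, WeierstrassCurve.map_map]
  exact congrArg V.map (RingHom.ext_int _ _)

/-- **A root of `ψ₃` is the abscissa of a point of order `3`**: for `ξ ∈ ℚ̄` with `ψ₃(ξ) = 0` there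
is a geometric point `P = (ξ, η)` of `V_ℚ` with `3P = O`. [folklore] -/
theorem exists_point_of_isRoot_Ψ₃ [hE : (V.map (Int.castRingHom ℚ)).IsElliptic]
    {ξ : AlgebraicClosure ℚ} (hξ : (V.Ψ₃.map (Int.castRingHom (AlgebraicClosure ℚ))).IsRoot ξ) :
    ∃ (P : (V.map (Int.castRingHom ℚ)).geomPoints) (η : AlgebraicClosure ℚ) (h : _),
      P = .some ξ η h ∧ (3 : ℤ) • P = 0 := by
  have e := baseChange_map_intCast_eq V
  -- an ordinate: root of the quadratic `Y² + (a₁ξ + a₃)Y - (ξ³ + a₂ξ² + a₄ξ + a₆)`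
  haveI hE' : (V.map (Int.castRingHom (AlgebraicClosure ℚ))).IsElliptic := by
    rw [← e]; infer_instance
  set q : (AlgebraicClosure ℚ)[X] := Polynomial.X ^ 2 +
    C ((V.map (Int.castRingHom (AlgebraicClosure ℚ))).a₁ * ξ +
      (V.map (Int.castRingHom (AlgebraicClosure ℚ))).a₃) * Polynomial.X -
    C (ξ ^ 3 + (V.map (Int.castRingHom (AlgebraicClosure ℚ))).a₂ * ξ ^ 2 +
      (V.map (Int.castRingHom (AlgebraicClosure ℚ))).a₄ * ξ +
      (V.map (Int.castRingHom (AlgebraicClosure ℚ))).a₆) with hq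
  have hqdeg : q.degree = 2 := by
    rw [hq]; compute_degree!
  obtain ⟨η, hη⟩ := IsAlgClosed.exists_root q (by rw [hqdeg]; norm_num)
  have heqn : (V.map (Int.castRingHom (AlgebraicClosure ℚ))).toAffine.Equation ξ η := by
    rw [Affine.equation_iff]
    have := hη; rw [hq, IsRoot.def] at this
    simp only [eval_sub, eval_add, eval_pow, eval_mul, eval_X, eval_C] at this
    linear_combination this
  have hns : (V.map (Int.castRingHom (AlgebraicClosure ℚ))).toAffine.Nonsingular ξ η :=
    Affine.equation_iff_nonsingular.mp heqn
  have hns' : (@WeierstrassCurve.baseChange ℚ _ (V.map (Int.castRingHom ℚ)) (AlgebraicClosure ℚ) _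
      (@AlgebraicClosure.instAlgebra ℚ _ ℚ _ _)).toAffine.Nonsingular ξ η := by rw [e]; exact hns
  refine ⟨.some ξ η hns', η, hns', rfl, ?_⟩
  have hΨ : ((@WeierstrassCurve.baseChange ℚ _ (V.map (Int.castRingHom ℚ)) (AlgebraicClosure ℚ) _
      (@AlgebraicClosure.instAlgebra ℚ _ ℚ _ _)).ΨSq 3).eval ξ = 0 := by
    rw [e, ΨSq_three, eval_pow, map_Ψ₃, hξ.eq_zero, zero_pow two_ne_zero]
  exact (zsmul_some_eq_zero_iff_eval_ΨSq _ hns' 3).mpr hΨ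

/-- **The multiplication-by-`3` relation above a point of order `3`**: for `P = (ξ, η)` with `3P = O`
there is `Q = (x, y)` with `3Q = P` (divisibility of `E(ℚ̄)`), hence `9Q = O`, and
`ξ · ψ₃(x)² = Φ₃(x)` on `V` read in `ℚ̄`. [folklore] -/
theorem exists_nineTorsion_over [hE : (V.map (Int.castRingHom ℚ)).IsElliptic]
    {P : (V.map (Int.castRingHom ℚ)).geomPoints} {ξ η : AlgebraicClosure ℚ} {h}
    (hP : P = .some ξ η h) (h3 : (3 : ℤ) • P = 0) :
    ∃ (Q : (V.map (Int.castRingHom ℚ)).geomPoints) (x y : AlgebraicClosure ℚ) (h' : _),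
      Q = .some x y h' ∧ (9 : ℤ) • Q = 0 ∧
        ξ * ((V.Ψ₃.map (Int.castRingHom (AlgebraicClosure ℚ))).eval x) ^ 2 =
          ((V.Φ 3).map (Int.castRingHom (AlgebraicClosure ℚ))).eval x := by
  have e := baseChange_map_intCast_eq V
  obtain ⟨Q, hQ⟩ := (V.map (Int.castRingHom ℚ)).zsmul_geomPoints_surjective_holds
    (n := 3) (by norm_num) P
  have hQ3 : (3 : ℤ) • Q = P := hQ
  have hP0 : P ≠ 0 := by rw [hP]; exact Affine.Point.some_ne_zero _
  have hQ0 : Q ≠ 0 := by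
    intro hQ0; apply hP0; rw [← hQ3, hQ0, smul_zero]
  obtain ⟨x, y, h', hQxy⟩ := geomPoints.exists_eq_some hQ0
  refine ⟨Q, x, y, h', hQxy, ?_, ?_⟩
  · rw [show (9 : ℤ) = 3 * 3 by norm_num, mul_smul, hQ3, h3]
  · subst hQxy; subst hP
    have key := mul_eval_ΨSq_of_zsmul_eq _ h' (3 : ℤ) h hQ3
    rw [e, ΨSq_three, eval_pow, map_Ψ₃, map_Φ] at key
    exact key

/-- Valuation facts of the `III`-shape, read in `ℚ̄`. [folklore] -/
theorem shape_valuations (hb2 : (3 : ℤ) ∣ V.b₂) (hb4 : (3 : ℤ) ∣ V.b₄) (hb4' : ¬ (9 : ℤ) ∣ V.b₄)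
    (hb6 : (9 : ℤ) ∣ V.b₆) :
    (placeOver 3).valuation (V.map (Int.castRingHom (AlgebraicClosure ℚ))).b₂ ≤
        (placeOver 3).valuation (3 : AlgebraicClosure ℚ) ∧
      (placeOver 3).valuation (V.map (Int.castRingHom (AlgebraicClosure ℚ))).b₄ =
        (placeOver 3).valuation (3 : AlgebraicClosure ℚ) ∧
      (placeOver 3).valuation (V.map (Int.castRingHom (AlgebraicClosure ℚ))).b₆ ≤
        (placeOver 3).valuation (3 : AlgebraicClosure ℚ) ^ 2 ∧
      (placeOver 3).valuation (V.map (Int.castRingHom (AlgebraicClosure ℚ))).b₈ =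
        (placeOver 3).valuation (3 : AlgebraicClosure ℚ) ^ 2 := by
  simp only [map_b₂, map_b₄, map_b₆, map_b₈, eq_intCast]
  refine ⟨?_, valuation_intCast_eq_of_dvd_of_not_dvd hb4 hb4', ?_,
    valuation_b₈_eq_of_shape V hb2 hb4 hb4' hb6⟩
  · simpa using valuation_intCast_le_pow_of_dvd (n := V.b₂) (k := 1) (by simpa using hb2)
  · exact valuation_intCast_le_pow_of_dvd (n := V.b₆) (k := 2) (by norm_num; exact hb6)

/-- **CASE A (`3 ∥ b₂`): a point `Q` of `V_ℚ(ℚ̄)` with `9Q = O` and abscissa of valuation `13/27`**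
(`v(x)²⁷ = v(3)¹³`, `x ≠ 0`): the point above a `3`-torsion point whose abscissa has
`v(ξ)³ = v(3)` (`exists_isRoot_Ψ₃_valuation_pow_three_eq`), by S2
(`valuation_pow_nine_eq_of_mul_rel`). [folklore] -/
theorem exists_nineTorsion_valuation_pow_27_eq [hE : (V.map (Int.castRingHom ℚ)).IsElliptic]
    (hb2 : (3 : ℤ) ∣ V.b₂) (hb2' : ¬ (9 : ℤ) ∣ V.b₂) (hb4 : (3 : ℤ) ∣ V.b₄) (hb4' : ¬ (9 : ℤ) ∣ V.b₄)
    (hb6 : (9 : ℤ) ∣ V.b₆) :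
    ∃ (Q : (V.map (Int.castRingHom ℚ)).geomPoints) (x y : AlgebraicClosure ℚ) (h : _),
      Q = .some x y h ∧ (9 : ℤ) • Q = 0 ∧ x ≠ 0 ∧
        (placeOver 3).valuation x ^ 27 = (placeOver 3).valuation (3 : AlgebraicClosure ℚ) ^ 13 := by
  obtain ⟨ξ, hξ, hvξ⟩ := exists_isRoot_Ψ₃_valuation_pow_three_eq V hb2 hb2' hb4 hb4' hb6
  obtain ⟨P, η, h, hP, hP3⟩ := exists_point_of_isRoot_Ψ₃ V hξ
  obtain ⟨Q, x, y, h', hQ, hQ9, hrel⟩ := exists_nineTorsion_over V hP hP3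
  obtain ⟨hb2v, hb4v, hb6v, hb8v⟩ := shape_valuations V hb2 hb4 hb4' hb6
  have hξ1 := valuation_le_one_of_isRoot_Ψ₃ V hb2 hb4 hb6 hξ
  have hrel' : ξ * ((V.map (Int.castRingHom (AlgebraicClosure ℚ))).Ψ₃.eval x) ^ 2 =
      ((V.map (Int.castRingHom (AlgebraicClosure ℚ))).Φ 3).eval x := by
    rw [map_Ψ₃, map_Φ]; exact hrel
  have h9 := valuation_pow_nine_eq_of_mul_rel (V.map (Int.castRingHom (AlgebraicClosure ℚ)))
    hb2v hb4v.le hb6v hb8v hrel' hξ1 hvξ.symm.le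
  set v := (placeOver 3).valuation with hv
  set t := v (3 : AlgebraicClosure ℚ) with ht
  have ht0 : t ≠ 0 := valuation_three_ne_zero
  have h27 : v x ^ 27 = t ^ 13 := by
    calc v x ^ 27 = (v x ^ 9) ^ 3 := by rw [← pow_mul]
      _ = (v ξ * t ^ 4) ^ 3 := by rw [h9]
      _ = v ξ ^ 3 * t ^ 12 := by rw [mul_pow, ← pow_mul]
      _ = t * t ^ 12 := by rw [hvξ]
      _ = t ^ 13 := by rw [← pow_succ']
  refine ⟨Q, x, y, h', hQ, hQ9, ?_, h27⟩
  intro hx0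
  rw [hx0, map_zero, zero_pow (by norm_num)] at h27
  exact pow_ne_zero 13 ht0 h27.symm

/-- **CASE B (`9 ∣ b₂`): a point `P` of order `3` with abscissa of valuation `1/4`**
(`v(ξ)⁴ = v(3)`, `ξ ≠ 0`). [folklore] -/
theorem exists_threeTorsion_valuation_pow_4_eq [hE : (V.map (Int.castRingHom ℚ)).IsElliptic]
    (hb2 : (9 : ℤ) ∣ V.b₂) (hb4 : (3 : ℤ) ∣ V.b₄) (hb4' : ¬ (9 : ℤ) ∣ V.b₄) (hb6 : (9 : ℤ) ∣ V.b₆) :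
    ∃ (P : (V.map (Int.castRingHom ℚ)).geomPoints) (ξ η : AlgebraicClosure ℚ) (h : _),
      P = .some ξ η h ∧ (3 : ℤ) • P = 0 ∧ ξ ≠ 0 ∧
        (placeOver 3).valuation ξ ^ 4 = (placeOver 3).valuation (3 : AlgebraicClosure ℚ) := by
  set K := AlgebraicClosure ℚ
  have ht0 : (placeOver 3).valuation (3 : K) ≠ 0 := valuation_three_ne_zero
  -- a root of `ψ₃` (degree 4) in `ℚ̄`
  set F := V.Ψ₃.map (Int.castRingHom K) with hF
  have hdeg : F.natDegree = 4 := by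
    rw [hF, natDegree_map_eq_of_injective (Int.castRingHom K).injective_int]
    exact V.natDegree_Ψ₃ (by norm_num)
  obtain ⟨ξ, hξ⟩ := IsAlgClosed.exists_root F
    (by rw [degree_eq_natDegree (by rintro h0; rw [h0, natDegree_zero] at hdeg; exact absurd hdeg (by norm_num)), hdeg]; norm_num)
  obtain ⟨P, η, h, hP, hP3⟩ := exists_point_of_isRoot_Ψ₃ V hξ
  have hv4 := valuation_pow_four_eq_of_isRoot_Ψ₃ V hb2 hb4 hb4' hb6 hξ
  refine ⟨P, ξ, η, h, hP, hP3, ?_, hv4⟩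
  intro hx0
  rw [hx0, map_zero, zero_pow (by norm_num)] at hv4
  exact ht0 hv4.symm

/-- **CASE B (`9 ∣ b₂`): a point `Q` with `9Q = O` and abscissa of valuation `17/36`**
(`v(x)³⁶ = v(3)¹⁷`, `x ≠ 0`), above any point of order `3` (abscissa `v(ξ)⁴ = v(3)`), by S2.
[folklore] -/
theorem exists_nineTorsion_valuation_pow_36_eq [hE : (V.map (Int.castRingHom ℚ)).IsElliptic]
    (hb2 : (9 : ℤ) ∣ V.b₂) (hb4 : (3 : ℤ) ∣ V.b₄) (hb4' : ¬ (9 : ℤ) ∣ V.b₄) (hb6 : (9 : ℤ) ∣ V.b₆) :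
    ∃ (Q : (V.map (Int.castRingHom ℚ)).geomPoints) (x y : AlgebraicClosure ℚ) (h : _),
      Q = .some x y h ∧ (9 : ℤ) • Q = 0 ∧ x ≠ 0 ∧
        (placeOver 3).valuation x ^ 36 = (placeOver 3).valuation (3 : AlgebraicClosure ℚ) ^ 17 := by
  have hb2' : (3 : ℤ) ∣ V.b₂ := dvd_trans ⟨3, by norm_num⟩ hb2
  obtain ⟨P, ξ, η, h, hP, hP3, hξ0, hvξ⟩ := exists_threeTorsion_valuation_pow_4_eq V hb2 hb4 hb4' hb6
  obtain ⟨Q, x, y, h', hQ, hQ9, hrel⟩ := exists_nineTorsion_over V hP hP3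
  obtain ⟨hb2v, hb4v, hb6v, hb8v⟩ := shape_valuations V hb2' hb4 hb4' hb6
  set v := (placeOver 3).valuation with hv
  set t := v (3 : AlgebraicClosure ℚ) with ht
  have ht1 : t < 1 := valuation_three_lt_one
  have ht0 : t ≠ 0 := valuation_three_ne_zero
  have hξ1 : v ξ ≤ 1 := by
    -- `v ξ ^ 4 = t < 1`
    by_contra hlt
    rw [not_le] at hlt
    have : 1 < v ξ ^ 4 := one_lt_pow₀ hlt (by norm_num)
    rw [hvξ] at this
    exact absurd (ht1.trans this) (lt_irrefl _)
  have hξ3 : t ≤ v ξ ^ 3 :=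
    calc t = v ξ ^ 4 := hvξ.symm
      _ ≤ v ξ ^ 3 := pow_le_pow_of_le_one' hξ1 (by norm_num)
  have hrel' : ξ * ((V.map (Int.castRingHom (AlgebraicClosure ℚ))).Ψ₃.eval x) ^ 2 =
      ((V.map (Int.castRingHom (AlgebraicClosure ℚ))).Φ 3).eval x := by
    rw [map_Ψ₃, map_Φ]; exact hrel
  have h9 := valuation_pow_nine_eq_of_mul_rel (V.map (Int.castRingHom (AlgebraicClosure ℚ)))
    hb2v hb4v.le hb6v hb8v hrel' hξ1 hξ3
  have h36 : v x ^ 36 = t ^ 17 := by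
    calc v x ^ 36 = (v x ^ 9) ^ 4 := by rw [← pow_mul]
      _ = (v ξ * t ^ 4) ^ 4 := by rw [h9]
      _ = v ξ ^ 4 * t ^ 16 := by rw [mul_pow, ← pow_mul]
      _ = t * t ^ 16 := by rw [hvξ]
      _ = t ^ 17 := by rw [← pow_succ']
  refine ⟨Q, x, y, h', hQ, hQ9, ?_, h36⟩
  intro hx0
  rw [hx0, map_zero, zero_pow (by norm_num)] at h36
  exact pow_ne_zero 17 ht0 h36.symm

end Summit.BirchSwinnertonDyer.Rank1Residual.GaloisImage

end
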